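import Literature.NumberTheory.EllipticCurves.CanonicalPAdicHeightCycLocusProofs
import Literature.NumberTheory.EllipticCurves.CanonicalPAdicHeightCycParallelogramProofs
import HarnessLib

/-!
# Existence of THE canonical cyclotomic `p`-adic height datum over a number field `H`, ANY prime `p`,
# from a sigma-squared pair of `W ⊗ ℚ_p` (proofs only)

Topic `Literature/NumberTheory/EllipticCurves` (trunk T-NT-EC); PROOFS file (theorems only). The
assembly of the programme proving the named fact `WeierstrassCurve.exists_isCanonicalCyc`
(`CanonicalPAdicHeightCyc.lean`) for EVERY prime `p` and EVERY number field `H` (no splitting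
assumption), for `W/ℚ` elliptic with integer coefficients, GIVEN a sigma-squared pair of `W ⊗ ℚ_p`
(`IsMazurTateSigmaSqPair`; supplied at every good ordinary prime by the tree's Mazur–Tate existence
theorems, see `CanonicalPAdicHeightCycExistenceHolds.lean`). It generalises the `p = 2` assembly
`exists_isCanonicalCyc_two_of_pair` (`CanonicalPAdicHeightCycExistenceTwoProofs.lean`).
Mazur–Stein–Tate 2006 §2.6–2.8 run on `Σ = σ²` with the `p`-part read at the `[H:ℚ]` embeddings
`H → ℂ_p`:

1. the subgroups `G ≤ A ≤ E(H)` of `exists_addSubgroups_cycLocus` (`A` ⊇ admissible locus,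
   `Aut(H/ℚ)`-stable; `G` torsion-free; every `P ∈ A` has some `pᵏ·P ∈ G`);
2. the parallelogram law of `q = [H:ℚ]⁻¹ · ĥ` on generic pairs of `A`
   (`canonicalPAdicHeightCyc_parallelogram`);
3. Jordan–von Neumann on the torsion-free `G` (`parallelogram_of_generic`,
   `exists_pairing_of_parallelogram`) gives a pairing `B` with `B(P,P) = q(P)` on `G`;
4. **the cyclic-group trick** (new w.r.t. `p = 2`, replacing the sharp `p`-torsion bound
   `ord_p z ≤ 1/(p−1)` that would make `A` itself torsion-free): for a NON-TORSION `P ∈ A` the cyclic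
   group `ℤ·P ≤ A` is torsion-free, so the generic law restricted to it gives `q(n·P) = n² q(P)`
   (Jordan–von Neumann on `ℤ·P`); with `pᵏ·P ∈ G`: `p^{2k} B(P,P) = B(pᵏP,pᵏP) = q(pᵏP) = p^{2k} q(P)`,
   whence `B(P,P) = q(P)` for every non-torsion `P ∈ A`, in particular every admissible `P`;
5. the AVERAGE over the finite group `Aut(H/ℚ)` (invariance), canonical on admissible points by
   `canonicalPAdicHeightCyc_pointGalHom` and the `Aut(H/ℚ)`-stability of `A`.

Result: `exists_isCanonicalCyc_of_pair` — `∃ DH : PAdicHeightDataK W p H, DH.IsCanonicalCyc ∧`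
(`Aut(H/ℚ)`-invariance), the conclusion of `exists_isCanonicalCyc` without its
`IsGloballyMinimal`/ordinarity binders (they only make the predicate meaningful and supply the pair).
BSD is not proved by any of this.

## References

* B. Mazur, W. Stein, J. Tate, Doc. Math. Extra Vol. Coates (2006), §1, §2.6–2.8. [MazurSteinTate2006]
* D. Disegni, Compos. Math. 153 (2017), §1.3.1, §4.1.1 (4.1.7)–(4.1.8). [Disegni2017]
* P. Schneider, Invent. Math. 69 (1982), §1. [Schneider1982]
-/

noncomputable section

open scoped Classical
open IsDedekindDomain NumberField WeierstrassCurve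

namespace Literature.NumberTheory.EllipticCurves

variable (W : WeierstrassCurve ℚ) [W.IsElliptic] [W.IsIntegral ℤ] (p : ℕ) [Fact p.Prime]
  (H : Type) [Field H] [NumberField H]

omit [W.IsElliptic] [W.IsIntegral ℤ] in
/-- `τ⁻¹(τP) = P` for the action of `Aut(H/ℚ)` on `E(H)` (`pointGalHom` is a monoid homomorphism).
[folklore] -/
private theorem pointGalHom_inv_apply (τ : H ≃ₐ[ℚ] H) (P : (W.baseChange H).toAffine.Point) :
    pointGalHom W H τ⁻¹ (pointGalHom W H τ P) = P := by
  change (pointGalHom W H τ⁻¹ * pointGalHom W H τ) P = P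
  rw [← map_mul, inv_mul_cancel, map_one]
  rfl

omit [W.IsElliptic] [W.IsIntegral ℤ] in
/-- `Aut(H/ℚ)` preserves non-torsion points of `E(H)`. [folklore] -/
private theorem not_isOfFinAddOrder_pointGalHom (τ : H ≃ₐ[ℚ] H) {P : (W.baseChange H).toAffine.Point}
    (hP : ¬ IsOfFinAddOrder P) : ¬ IsOfFinAddOrder (pointGalHom W H τ P) := fun h => by
  have h' := (pointGalHom W H τ⁻¹).isOfFinAddOrder h
  refine hP ?_
  convert h' using 1
  exact (pointGalHom_inv_apply W H τ P).symm

/-- `B(n·P, n·P) = n² B(P, P)` for a biadditive pairing. [folklore] -/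
private theorem biadditive_apply_nsmul_nsmul {M : Type*} [AddCommGroup M] {L : Type*} [Field L]
    (B : M →+ M →+ L) (n : ℕ) (P : M) : B (n • P) (n • P) = (n : L) ^ 2 * B P P := by
  rw [map_nsmul (B (n • P)) n P, ← AddMonoidHom.flip_apply B (n • P) P, map_nsmul (B.flip P) n P,
    AddMonoidHom.flip_apply, nsmul_eq_mul, nsmul_eq_mul]
  ring

/-- **Quadraticity along a non-torsion point from the generic parallelogram law.** If `q : M → L`
(`L` a field of characteristic zero, `M` an additive commutative group) vanishes at `0` and satisfies
the parallelogram law on the GENERIC pairs (`P, Q, P ± Q ≠ 0`) of a subgroup `A`, then for every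
NON-TORSION `P ∈ A` and every `n`, `q(n·P) = n²·q(P)`: the cyclic group `ℤ·P ≤ A` is torsion-free,
so Jordan–von Neumann applies to it (`parallelogram_of_generic`, `exists_pairing_of_parallelogram`)
and `q` is there the quadratic form of a biadditive pairing.
[cite: MazurSteinTate2006, §2.6 (PDF p. 10 L10–17: «replacing α, β by m·α, n·β …»)] -/
theorem parallelogram_generic_nsmul_sq {M : Type*} [AddCommGroup M] {L : Type*} [Field L] [CharZero L]
    (A : AddSubgroup M) (q : M → L) (h0 : q 0 = 0)
    (hq : ∀ P ∈ A, ∀ Q ∈ A, P ≠ 0 → Q ≠ 0 → P - Q ≠ 0 → P + Q ≠ 0 →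
      q (P + Q) + q (P - Q) = 2 * q P + 2 * q Q)
    {P : M} (hP : P ∈ A) (hnt : ¬ IsOfFinAddOrder P) (n : ℕ) :
    q (n • P) = (n : L) ^ 2 * q P := by
  set Z := AddSubgroup.zmultiples P with hZ
  have hZA : Z ≤ A := (AddSubgroup.zmultiples_le_of_mem hP)
  have hZtf : ∀ Q ∈ Z, IsOfFinAddOrder Q → Q = 0 := by
    intro Q hQ hfin
    obtain ⟨m, rfl⟩ := AddSubgroup.mem_zmultiples_iff.mp hQ
    by_cases hm : m = 0
    · rw [hm, zero_zsmul]
    exfalso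
    apply hnt
    obtain ⟨k, hk, hkm⟩ := (isOfFinAddOrder_iff_zsmul_eq_zero).mp hfin
    rw [smul_smul] at hkm
    exact (isOfFinAddOrder_iff_zsmul_eq_zero).mpr ⟨k * m, mul_ne_zero hk hm, hkm⟩
  have hgenZ : ∀ P ∈ Z, ∀ Q ∈ Z, P ≠ 0 → Q ≠ 0 → P - Q ≠ 0 → P + Q ≠ 0 →
      q (P + Q) + q (P - Q) = 2 * q P + 2 * q Q :=
    fun P hP Q hQ => hq P (hZA hP) Q (hZA hQ)
  have hfullZ := parallelogram_of_generic Z hZtf q h0 hgenZ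
  obtain ⟨B, -, -, hdiag⟩ := exists_pairing_of_parallelogram Z q hfullZ
  have hPZ : P ∈ Z := AddSubgroup.mem_zmultiples P
  rw [← hdiag _ (Z.nsmul_mem hPZ n), ← hdiag _ hPZ]
  exact biadditive_apply_nsmul_nsmul B n P

/-- **Existence of THE canonical cyclotomic `p`-adic height datum over a number field `H`, any prime
`p`**, for `W/ℚ` elliptic with integer coefficients, from a sigma-squared pair of `W ⊗ ℚ_p` (no
assumption on the splitting of `p` in `H`): there is a symmetric bilinear torsion-vanishing pairing on
`E(H)`, invariant under `Aut(H/ℚ)`, whose quadratic form on every `p`-adically admissible point is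
`[H:ℚ]⁻¹ · (log_p N𝔡_H(x) − Σ_{w∣p} log_p N_{H_w/ℚ_p} Σ_p(z))` (`IsCanonicalCyc`). This is the
conclusion of the named fact `exists_isCanonicalCyc` at `p` (MST 2006 §2.6–2.8 on `Σ = σ²`, the
`p`-part read at the embeddings `H → ℂ_p`; Jordan–von Neumann on the torsion-free core `G`, the value
on admissible points through the torsion-free cyclic groups `ℤ·P` and a `p`-power multiple in `G`,
average over `Aut(H/ℚ)`). [cite: MazurSteinTate2006, §2.8 (PDF p. 11 L33–58)]
[cite: Disegni2017, §1.3.1 (arXiv v3 PDF p. 7 L30–38)] [cite: Schneider1982, §1] -/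
theorem exists_isCanonicalCyc_of_pair
    (hpair : ∃ Sq : PowerSeries ℚ_[p], ∃ c : ℚ_[p], (W.baseChange ℚ_[p]).IsMazurTateSigmaSqPair Sq c) :
    ∃ DH : PAdicHeightDataK W p H, DH.IsCanonicalCyc ∧
      ∀ (σ : H ≃ₐ[ℚ] H) (a b : (W.baseChange H).toAffine.Point),
        DH.pairing (pointGalHom W H σ a) (pointGalHom W H σ b) = DH.pairing a b := by
  have hp : p.Prime := Fact.out
  -- (1) the subgroups
  obtain ⟨A, G, hGA, htf, hloc, hfacts, hcontr, hstab⟩ := exists_addSubgroups_cycLocus W p H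
  -- (2) the scaled height formula and its parallelogram law on generic pairs of `A`
  set c : ℚ_[p] := ((Module.finrank ℚ H : ℕ) : ℚ_[p])⁻¹ with hc
  set q : (W.baseChange H).toAffine.Point → ℚ_[p] := fun P => c * W.canonicalPAdicHeightCyc p H P
    with hq
  have hq0 : q 0 = 0 := by simp only [hq, WeierstrassCurve.canonicalPAdicHeightCyc_zero, mul_zero]
  have hgenA : ∀ P ∈ A, ∀ Q ∈ A, P ≠ 0 → Q ≠ 0 → P - Q ≠ 0 → P + Q ≠ 0 →
      q (P + Q) + q (P - Q) = 2 * q P + 2 * q Q := by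
    intro P hP Q hQ hP0 hQ0 hsub hadd
    rcases P with _ | ⟨x₁, y₁, h₁⟩
    · exact (hP0 rfl).elim
    rcases Q with _ | ⟨x₂, y₂, h₂⟩
    · exact (hQ0 rfl).elim
    have hx : x₁ ≠ x₂ := X_ne_of_sub_ne_zero_of_add_ne_zero h₁ h₂ hsub hadd
    have hPQ := A.add_mem hP hQ
    have hPQ' := A.sub_mem hP hQ
    rcases hS : (.some x₁ y₁ h₁ : (W.baseChange H).toAffine.Point) + .some x₂ y₂ h₂ with _ | ⟨x₃, y₃, h₃⟩
    · exact (hadd hS).elim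
    rcases hD : (.some x₁ y₁ h₁ : (W.baseChange H).toAffine.Point) - .some x₂ y₂ h₂ with _ | ⟨x₄, y₄, h₄⟩
    · exact (hsub hD).elim
    rw [hS] at hPQ
    rw [hD] at hPQ'
    obtain ⟨hσ₁, hns₁⟩ := hfacts h₁ hP
    obtain ⟨hσ₂, hns₂⟩ := hfacts h₂ hQ
    obtain ⟨hσ₃, -⟩ := hfacts h₃ hPQ
    obtain ⟨hσ₄, -⟩ := hfacts h₄ hPQ'
    have key := canonicalPAdicHeightCyc_parallelogram hpair h₁ h₂ h₃ h₄ hS hD hx hσ₁ hσ₂ hσ₃ hσ₄ hns₁ hns₂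
    rw [hS, hD]
    simp only [hq]
    linear_combination c * key
  -- (3) Jordan–von Neumann on the torsion-free core `G`
  have hgenG : ∀ P ∈ G, ∀ Q ∈ G, P ≠ 0 → Q ≠ 0 → P - Q ≠ 0 → P + Q ≠ 0 →
      q (P + Q) + q (P - Q) = 2 * q P + 2 * q Q :=
    fun P hP Q hQ => hgenA P (hGA hP) Q (hGA hQ)
  have hfull := parallelogram_of_generic G htf q hq0 hgenG
  obtain ⟨B, hsymm, htors, hdiag⟩ := exists_pairing_of_parallelogram G q hfull
  -- (4) the cyclic-group trick: `B(P,P) = q(P)` for every NON-TORSION `P ∈ A`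
  have hkey : ∀ P ∈ A, ¬ IsOfFinAddOrder P → B P P = q P := by
    intro P hP hnt
    obtain ⟨k, hk⟩ := hcontr P hP
    have h1 : B ((p ^ k) • P) ((p ^ k) • P) = ((p ^ k : ℕ) : ℚ_[p]) ^ 2 * B P P :=
      biadditive_apply_nsmul_nsmul B (p ^ k) P
    have h2 : B ((p ^ k) • P) ((p ^ k) • P) = q ((p ^ k) • P) := hdiag _ hk
    have h3 : q ((p ^ k) • P) = ((p ^ k : ℕ) : ℚ_[p]) ^ 2 * q P :=
      parallelogram_generic_nsmul_sq A q hq0 hgenA hP hnt (p ^ k)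
    have hne : ((p ^ k : ℕ) : ℚ_[p]) ^ 2 ≠ 0 :=
      pow_ne_zero 2 (by exact_mod_cast pow_ne_zero k hp.ne_zero)
    exact mul_left_cancel₀ hne (h1.symm.trans (h2.trans h3))
  -- (5) the average over `Aut(H/ℚ)`
  set Γ := (H ≃ₐ[ℚ] H)
  set e : ℚ_[p] := ((Fintype.card Γ : ℕ) : ℚ_[p])⁻¹ with he
  have hcard : ((Fintype.card Γ : ℕ) : ℚ_[p]) ≠ 0 := by exact_mod_cast Fintype.card_ne_zero
  let avg₀ : (W.baseChange H).toAffine.Point → (W.baseChange H).toAffine.Point →+ ℚ_[p] := fun a =>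
    { toFun := fun b => e * ∑ τ : Γ, B (pointGalHom W H τ a) (pointGalHom W H τ b)
      map_zero' := by simp
      map_add' := fun b b' => by
        simp only [map_add, Finset.sum_add_distrib, mul_add] }
  let avg : (W.baseChange H).toAffine.Point →+ (W.baseChange H).toAffine.Point →+ ℚ_[p] :=
    { toFun := avg₀
      map_zero' := by ext b; simp [avg₀]
      map_add' := fun a a' => by
        ext b
        simp only [avg₀, map_add, AddMonoidHom.add_apply, AddMonoidHom.coe_mk, ZeroHom.coe_mk,
          Finset.sum_add_distrib, mul_add] }
  have havg : ∀ a b, avg a b = e * ∑ τ : Γ, B (pointGalHom W H τ a) (pointGalHom W H τ b) :=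
    fun _ _ => rfl
  refine ⟨⟨avg, fun a b => ?_, fun a b ha => ?_⟩, ?_, ?_⟩
  · -- symmetry
    rw [havg, havg]
    exact congrArg _ (Finset.sum_congr rfl fun τ _ => hsymm _ _)
  · -- torsion
    rw [havg]
    have : ∀ τ : Γ, B (pointGalHom W H τ a) (pointGalHom W H τ b) = 0 := fun τ =>
      htors _ _ ((pointGalHom W H τ).isOfFinAddOrder ha)
    simp [this]
  · -- canonical on admissible points
    intro P hP
    have hPA : P ∈ A := hloc P hP.2
    change avg P P = _
    rw [havg]
    have hτ : ∀ τ : Γ, B (pointGalHom W H τ P) (pointGalHom W H τ P) =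
        c * W.canonicalPAdicHeightCyc p H P := fun τ => by
      rw [hkey _ (hstab τ P hPA) (not_isOfFinAddOrder_pointGalHom W H τ hP.1)]
      simp only [hq, canonicalPAdicHeightCyc_pointGalHom]
    simp only [hτ, Finset.sum_const, Finset.card_univ, nsmul_eq_mul]
    rw [he, ← mul_assoc, inv_mul_cancel₀ hcard, one_mul, hc]
  · -- invariance under `Aut(H/ℚ)`
    intro σ a b
    change avg (pointGalHom W H σ a) (pointGalHom W H σ b) = avg a b
    rw [havg, havg]
    congr 1
    refine Fintype.sum_equiv (Equiv.mulRight σ) _ _ fun τ => ?_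
    simp only [Equiv.coe_mulRight, map_mul]
    rfl

end Literature.NumberTheory.EllipticCurves

end
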